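/-
SplitsliceG4.lean — crux workfile for `stmt-BirchSwinnertonDyer-20728`
(v1.1.1, g41: v1.1 + DEDUP NOTE below (docstring only); v1.1 = + §5 «the parasite is a global factor —
no engine slot G1″»; v1.0 content unchanged)
(`SignedBaseChange.TwoVariableEulerSystemDivisibility`), idea `splitslice`, residual **G4**
(the per-line Euler-system bound along the `v̄`-pencil and its hand-over to door 5).

HONEST FRAMING. Nothing in this file proves the crux, the route, or BSD. It is a COMPANION of
`QtameDoor5.lean` v1.2 / `SplitsliceG2*.lean` / `SplitsliceG3.lean` / `SplitsliceG5*.lean`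
(all published on this item with `ledger crux write`); the skeleton of record `Lines/ratlift.lean`
v5.4 is untouched. What is PROVED here is commutative algebra over an abstract Noetherian
factorial domain `R` (instantiated to a fibre ring `O⟦T₁⟧`, `O` a DVR) plus the bookkeeping that
turns the output into door 5's `FibreBoundAt` slot; the ARITHMETIC inputs of a line (Kolyvagin-system
bound, explicit reciprocity law, Poitou–Tate sequence, fibre control) enter as HYPOTHESES on abstract
modules and are named and sourced in the module docstring. No `sorry`, no new axioms, no instances,
no notation; imports tree `Literature` only (Cruxes modules are not importable on the farm, so the
three door-5 one-liners `verticalPrimeO` / `fibreSection` / `FibreBoundAt` are COPIED verbatim, §1).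
DEDUP NOTE (critic V#26cc n2, v1.1.1). The following declarations of §1 are COPIES, byte-for-byte in
statement, of door 5's originals in `Cruxes/TwoVariableEulerSystemDivisibility/QtameDoor5.lean` v1.2
(namespace `…Cruxes.TwoVariableEulerSystemDivisibility.QtameDoor5`): `verticalPrimeO`, `fibreSection`,
`FibreBoundAt` (the audit flags `FibreBoundAt` and its parasite form `FibreBoundAtPar` as vendored-fact
`def … : Prop`). They exist here ONLY because Cruxes modules are not importable on the farm; when they
become importable, or if door 5's originals are ever promoted to `Theorems/` / `Literature/`, DELETE the
copies here and refer to the originals by name (dedup.fqn) — every theorem of this file is stated so that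
the replacement is a pure rename (`FibreBoundAtPar` is then `FibreBoundAt … (parasiteO O u₁ ^ m * G) u t`
by `fibreBoundAtPar_iff_fibreBoundAt_mul`, §5).
-/
import Literature.NumberTheory.EllipticCurves.IwasawaAlgebraRankOneIdealProofs
import Literature.NumberTheory.EllipticCurves.IwasawaAlgebraPromotionProofs
import Literature.NumberTheory.IwasawaTheory.IwasawaAlgebraTwoVarRegularProofs
import HarnessLib

/-!
# SplitsliceG4 — the LINE ENDGAME: from one line's (KS, ERL, PT, CTRL) to door 5's fibre bound

Ideator workfile (planner `bsd-idea-14`, generation g41) for the crux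
`Summit.BirchSwinnertonDyer.BirchSwinnertonDyer.Theses.SignedBaseChange.TwoVariableEulerSystemDivisibility`
(integral two-variable Euler-system divisibility `(G) ⊆ ch_{Λ₂^ur}(X_Gr₂)` for `E/K` at a supersingular
prime `p = v v̄` split in `K`, `a_p = 0`). Line `ratlift`, idea `splitslice` (door 5: patch the
two-variable divisibility from fibre bounds along the TWO split pencils `{μ₀} × Γ̂_v̄` and, after the
`τ`-transport of `SplitsliceG2/G3`, `Γ̂_v × {μ₀}`).

## What door 5 consumes and what was missing

Door 5 (`QtameDoor5.lean` v1.2, `classical_dvd` / `engine_door5*`) consumes, at every deep point `u`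
of a pencil over a finite flat DVR `O/ℤ_p`, the slot

  `FibreBoundAt O p Y G u t : p^t · G ∈ ch_{O⟦T₁⟧}(Y/(T₂-u)Y)·(section) + (T₂ - u)`

(`Y = Λ_{2,O} ⊗_{Λ₂} X_Gr₂`). The door-5 companions contain the CONSUMERS of this slot
(`ClassicalFibreBounds(Pt)`, `classicalFibreBounds_of_C_mul`, `fibreBoundOver_of_C_mul`) but no
PRODUCER: no kernel theorem turns "one rational Euler-system argument along the line" into
`FibreBoundAt`. Residual G4 of the `splitslice` card is exactly that producer. This file supplies it,
with the arithmetic of the line abstracted into four named hypotheses.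

## The line argument (CCSS18 §5, (eq:PT1); BL16 Thm. 4.18 (i); MR04 Thm. 5.3.10) — dictionary

Fix a deep point `u` (a character `μ₀` of `Γ_v` of conductor `v^{n+1}`, `n ≥ N`), `O = ℤ_p^ur[μ₀]`,
`R = O⟦T₁⟧ = Λ_ℓ` the Iwasawa algebra of the line `ℓ = {μ₀} × Γ̂_v̄`, `T_ℓ = T_f(μ₀⁻¹) ⊗ Λ(Γ_v̄)^ι`.
The abstract data of §3 and their arithmetic meaning:

* `Hrel`  ↦ `Sel^{•,rel}_ℓ = H¹_{F}(K, T_ℓ)`, `F` = (signed `•` at `v`, relaxed at `v̄`);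
* `Hloc`  ↦ `H¹_•(K_v, T_ℓ)` (the signed local condition at `v`, a rank-one `Λ_ℓ`-module);
* `Xrs`   ↦ `X^{rel,str}_ℓ = Sel_{rel,str}(K, A_ℓ)^∨`;  `Xss` ↦ `X^{•,str}_ℓ = Sel_{F*}(T_ℓ^*)^∨`;
* `res`   ↦ `loc_v`, injective because `Sel^{str,rel}_ℓ = 0` (ES non-vanishing on the line);
* `δ, πs` ↦ the Poitou–Tate maps of `0 → Sel^{•,rel} → H¹_•(K_v) → X^{rel,str} → X^{•,str} → 0`
            [CCSS18 (eq:PT1) in the proof of Thm. 3.7, arXiv:1804.10993 p. 14–15];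
* `z`     ↦ the line class `BF^•_ℓ` (two-variable signed Beilinson–Flach class specialised to `ℓ`);
* `Log`   ↦ the specialised signed regulator `L̃og^•_ℓ : H¹_•(K_v, T_ℓ) → Λ_ℓ` (injective on deep
            lines: the determinant of `(Col^•, L̃og^•)` on the rank-two `H¹(K_v, 𝐓)` is a non-zero
            element of `Λ₂`, divisible by only finitely many vertical primes);
* (KS_ℓ)  `Module.IsTorsion R Xss ∧ char(Hrel/R·z) ≤ char(Xss)` ↦ the KOLYVAGIN-SYSTEM BOUND
            `char X^{•,str}_ℓ ∣ char(Sel^{•,rel}_ℓ / Λ_ℓ·BF^•_ℓ)` [MazurRubin2004 Thm. 5.3.10 (shape);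
            BL16 = arXiv:1605.05310 Thm. 4.18 (i) (two-variable, `p`-distinguished twists only);
            CCSS18 Thm. 5.7 (anticyclotomic analogue)] — the RESEARCH content of G4;
* (ERL_ℓ) `Log (res z) = e · π G`, `e ∣ p^t (T₁ - u₁)^m` ↦ the explicit reciprocity law
            `L̃og^•_𝔭(res_𝔭 BF^•_c) = c · 𝓛_𝔭(f/K)` [CCSS18 Thm. 3.6, arXiv:1804.10993 p. 14]
            specialised to the line: `L̃og_ℓ(loc_v BF^•_ℓ) = (unit · ϖ^r · (T₁-u₁)^m) · G|_ℓ`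
            (the parasite `(T₁ - u₁)^m` is the possible pole of `L̃og` at the crossing with
            `P = (γ_ac - 1)`, card §F-g37 / FD-CHECK-g37 §4.4; `c`, `ϖ^r` absorbed into `p^t`);
* (CTRL_ℓ) `LinearMap.IsPseudoIsomorphism ctrl`, `ctrl : Y/(T₂-u)Y → X^{rel,str}_ℓ` ↦ Greenberg-type
            control of the relaxed–strict two-variable Selmer group along `ℓ` [Greenberg, *Iwasawa
            theory for p-adic representations* §4; SkinnerUrban2014 Prop. 3.7-type].

THEOREM (§3–§4, kernel-checked): (PT_ℓ) + (KS_ℓ) + (ERL_ℓ) + (CTRL_ℓ) ⟹ `FibreBoundAtPar O p Y G u u₁ t m`,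
and for `m = 0` door 5's `FibreBoundAt O p Y G u t` verbatim. A by-product of the chase: NO hypothesis
on `coker L̃og_ℓ` is needed for the divisibility direction (`char(Hloc/R·res z) ⊇ (e·πG)` uses only
the injectivity of `Log`; CCSS18 invoke the pseudo-nullity of `coker L̃og^•_𝔭` (their Prop. 2.9) only
for the EQUALITY in Thm. 3.7) — one input fewer than the card's G4(b) list of g37.

## v1.1 (§5): the parasite is a GLOBAL factor — door 5 runs verbatim, the engine slot G1″ dissolves

CCSS18 p. 14 L1–11: `L̃og^•_𝔭` is «integral up to exceptional primes», the exceptional prime being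
`P = (γ_ac − 1)·Λ(Γ_K)` with generator `ϖ_P := γ_ac − 1 ∈ Λ₂`. Because `H¹_•(K_𝔭, 𝐓)` is finitely
generated, ONE exponent `m₀` makes `M := ϖ_P^{m₀} · L̃og^•_𝔭` integral (`exists_uniform_pow_smul_mem`,
the algebraic shadow: pointwise `ϖ`-power integrality of a linear map on a finitely generated module is
uniform). Specialising the INTEGRAL map `M` (not `L̃og`) to a line `ℓ` gives an (ERL_ℓ) of the shape
`M_ℓ (res z) = e · π(ϖ_P^{m₀} · G)`, `e ∣ p^t` (`e = c · ϖ_O^r · unit`; `M_ℓ` is injective where `L̃og_ℓ`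
is, `injective_smul_of_injective`) — i.e. EXACTLY the hypotheses of `fibreBoundAt_of_line` (v1.0, `m = 0`)
for the GLOBAL element `G' := ϖ_P^{m₀} · G` in place of `G` (`fibreBoundAt_parasiteFactor_of_line`).
Door 5 (`QtameDoor5.engine_door5*`) uses `G` only through the fibre bounds and the always-true
`PatchingTarget`, so it runs VERBATIM for `G'` and returns `∃ a, (p^a · ϖ_P^{m₀} · G) ⊆ ch(X)`; the factor
`ϖ_P^{m₀}` is then stripped by the tree's promotion lemma `Module.le_charIdeal_of_span_pow_mul_le`
given G5, `ℓ_P(X) = 0` (`SplitsliceG5red.g5_package` (ii); `strip_parasiteFactor`,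
`engine_output_of_parasiteFactor` — the latter over an ABSTRACT engine `FB G' → ∃ a, (p^a G') ⊆ ch X`,
since Cruxes modules are not importable). Consequently the parasite-tolerant engine slot G1″
(«door 5♭′», card §F-g37, blocked on the `QtameDoor5` byte cap) is NOT NEEDED: no engine change, no
new slot; v1.0's point-wise slot `FibreBoundAtPar` is kept and identified with the `G'`-form on each
line (`fibreBoundAtPar_iff_fibreBoundAt_mul`: it is `FibreBoundAt` for `parasiteO^m · G`, by `mul_assoc`).

## What remains research (not claimed here)

(KS_ℓ) for `T_ℓ` at a FROZEN ramified `μ₀` against the trivial-character CM branch: the two-variable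
`𝔏`-restricted Kolyvagin-system machine in print (BL16 Thm. 4.14/4.18, BL-ord App. A) needs a
`p`-distinguished twist (LLZ15 = arXiv:1311.0175 Prop. 5.2.3 / Rem. 5.1.3 freeness), which the branch
`χ = 𝟙` of `E` itself is not; CCSS18 Cor. 5.9 reaches the two-variable statement only through Wan's
Eisenstein-side divisibility plus a non-split ramified prime. So (KS_ℓ) per line is OPEN CONTENT of
the crux, typed here, not discharged. The parasite exponent is not known to vanish, but by §5
(v1.1) it costs nothing: door 5 is run for `ϖ_P^{m₀} · G` and G5 strips the factor — no slot G1″.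

## References

* [CCSS18] F. Castella, M. Çiperiani, C. Skinner, F. Sprung, *On the Iwasawa main conjectures for
  modular forms at non-ordinary primes*, arXiv:1804.10993 — Prop. 2.9, Thm. 3.1, Thm. 3.6 (ERL),
  (eq:PT1) in the proof of Thm. 3.7 (p. 14–15), Thm. 5.7, Cor. 5.9.
* [BL16] K. Büyükboduk, A. Lei, *Iwasawa theory of elliptic modular forms over imaginary quadratic
  fields at non-ordinary primes*, arXiv:1605.05310 — Thm. 4.14, 4.18, 4.19, App. A.
* [LLZ15] A. Lei, D. Loeffler, S. L. Zerbes, *Euler systems for modular forms over imaginary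
  quadratic fields*, arXiv:1311.0175 — Prop. 5.2.3, Rem. 5.1.3.
* [MazurRubin2004] B. Mazur, K. Rubin, *Kolyvagin systems*, Mem. AMS 799 — Thm. 5.3.10.
* [NeukirchSchmidtWingberg2008] Ch. V §3 (characteristic ideals in exact sequences).
* [Washington1997] §13.2; [BourbakiAC5to7] Ch. VII §4; [Matsumura1987] Thm. 19.5, 20.3.

#harness_tags iwasawa_theory.two_variable, euler_systems.kolyvagin_bound, bsd.supersingular
-/

set_option linter.dupNamespace false

noncomputable section

open scoped Pointwise

namespace Summit.BirchSwinnertonDyer.BirchSwinnertonDyer.Cruxes.TwoVariableEulerSystemDivisibility.SplitsliceG4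

open Literature.NumberTheory.EllipticCurves

universe u

/-! ## §1 Door-5 fibre vocabulary (verbatim copies of `QtameDoor5` v1.2 §2) and the parasite slot -/

section Fibres

variable (O : Type*) [CommRing O]

/-- COPY of `QtameDoor5.verticalPrimeO`: the vertical prime `T₂ - u` of `O⟦T₂⟧⟦T₁⟧` through the
point `u` of the inner disc, via the constants embedding `C : O⟦T₂⟧ → O⟦T₂⟧⟦T₁⟧`. [folklore] -/
def verticalPrimeO (u : O) : PowerSeries (PowerSeries O) :=
  PowerSeries.C (R := PowerSeries O) (PowerSeries.X - PowerSeries.C (R := O) u)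

/-- COPY of `QtameDoor5.fibreSection`: the section `O⟦T⟧ → O⟦T₂⟧⟦T₁⟧`, `T ↦ T₁`, constants to
constants (the `Λ_cyc`-structure of a fibre; NOT the constants map `PowerSeries.C`). [folklore] -/
def fibreSection : PowerSeries O →+* PowerSeries (PowerSeries O) :=
  PowerSeries.map (PowerSeries.C (R := O))

/-- The `O⟦T₁⟧`-module structure of the fibre `Y/(T₂ - u)Y` through `fibreSection` — the instance
door 5 installs with `letI` inside `FibreBoundAt` (named here so that statements can mention it).
[folklore] -/
abbrev fibreModule (u : O) (Y : Type*) [AddCommGroup Y] [Module (PowerSeries (PowerSeries O)) Y] :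
    Module (PowerSeries O) (QuotSMulTop (verticalPrimeO O u) Y) :=
  Module.compHom _ (fibreSection O)

/-- `ch_{O⟦T₁⟧}(Y/(T₂ - u)Y)`, the fibre's characteristic ideal for the `fibreSection` structure.
[folklore] -/
def fibreCharIdeal (u : O) (Y : Type*) [AddCommGroup Y] [Module (PowerSeries (PowerSeries O)) Y] :
    Ideal (PowerSeries O) :=
  letI : Module (PowerSeries O) (QuotSMulTop (verticalPrimeO O u) Y) := fibreModule O u Y
  Module.charIdeal (PowerSeries O) (QuotSMulTop (verticalPrimeO O u) Y)

/-- COPY of `QtameDoor5.FibreBoundAt` (door 5 v1.2 §2, definitionally equal): **fibre bound at `u`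
with slack `p^t`**, `p^t · G ∈ ch(fibre)·(section) + (T₂ - u)`. [folklore] -/
def FibreBoundAt (p : ℕ) (Y : Type*) [AddCommGroup Y] [Module (PowerSeries (PowerSeries O)) Y]
    (G : PowerSeries (PowerSeries O)) (u : O) (t : ℕ) : Prop :=
  letI : Module (PowerSeries O) (QuotSMulTop (verticalPrimeO O u) Y) :=
    Module.compHom _ (fibreSection O)
  (p : PowerSeries (PowerSeries O)) ^ t * G ∈
    (Literature.NumberTheory.EllipticCurves.Module.charIdeal (PowerSeries O)
        (QuotSMulTop (verticalPrimeO O u) Y)).map (fibreSection O) ⊔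
      Ideal.span {verticalPrimeO O u}

/-- The PARASITE `T₁ - u₁` at the crossing of the line with `V(P)`, as an element of `O⟦T₂⟧⟦T₁⟧`
(`= fibreSection (T - u₁)`). [folklore] -/
def parasiteO (u₁ : O) : PowerSeries (PowerSeries O) :=
  fibreSection O (PowerSeries.X - PowerSeries.C (R := O) u₁)

/-- **Fibre bound with parasite** (the G1″ slot of the card): `p^t · (T₁ - u₁)^m · G ∈
ch(fibre)·(section) + (T₂ - u)`. For `m = 0` it is `FibreBoundAt` (`fibreBoundAtPar_zero_iff`). [folklore] -/
def FibreBoundAtPar (p : ℕ) (Y : Type*) [AddCommGroup Y] [Module (PowerSeries (PowerSeries O)) Y]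
    (G : PowerSeries (PowerSeries O)) (u u₁ : O) (t m : ℕ) : Prop :=
  (p : PowerSeries (PowerSeries O)) ^ t * parasiteO O u₁ ^ m * G ∈
    (fibreCharIdeal O u Y).map (fibreSection O) ⊔ Ideal.span {verticalPrimeO O u}

variable {O}

theorem fibreBoundAt_iff (p : ℕ) (Y : Type*) [AddCommGroup Y] [Module (PowerSeries (PowerSeries O)) Y]
    (G : PowerSeries (PowerSeries O)) (u : O) (t : ℕ) :
    FibreBoundAt O p Y G u t ↔ (p : PowerSeries (PowerSeries O)) ^ t * G ∈
      (fibreCharIdeal O u Y).map (fibreSection O) ⊔ Ideal.span {verticalPrimeO O u} :=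
  Iff.rfl

/-- `m = 0`: the parasite slot IS door 5's slot. [folklore] -/
theorem fibreBoundAtPar_zero_iff (p : ℕ) (Y : Type*) [AddCommGroup Y]
    [Module (PowerSeries (PowerSeries O)) Y] (G : PowerSeries (PowerSeries O)) (u u₁ : O) (t : ℕ) :
    FibreBoundAtPar O p Y G u u₁ t 0 ↔ FibreBoundAt O p Y G u t := by
  rw [FibreBoundAtPar, fibreBoundAt_iff, pow_zero, mul_one]

/-- Monotonicity of the slot in the slack and the parasite exponent. [folklore] -/
theorem fibreBoundAtPar_mono {p : ℕ} {Y : Type*} [AddCommGroup Y]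
    [Module (PowerSeries (PowerSeries O)) Y] {G : PowerSeries (PowerSeries O)} {u u₁ : O} {t m t' m' : ℕ}
    (ht : t ≤ t') (hm : m ≤ m') (h : FibreBoundAtPar O p Y G u u₁ t m) :
    FibreBoundAtPar O p Y G u u₁ t' m' := by
  unfold FibreBoundAtPar at h ⊢
  obtain ⟨a, rfl⟩ := Nat.exists_eq_add_of_le ht
  obtain ⟨b, rfl⟩ := Nat.exists_eq_add_of_le hm
  have : (p : PowerSeries (PowerSeries O)) ^ (t + a) * parasiteO O u₁ ^ (m + b) * G =
      ((p : PowerSeries (PowerSeries O)) ^ a * parasiteO O u₁ ^ b) *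
        ((p : PowerSeries (PowerSeries O)) ^ t * parasiteO O u₁ ^ m * G) := by ring
  rw [this]
  exact Ideal.mul_mem_left _ _ h

end Fibres

/-! ## §2 Transport along an evaluation map `π : O⟦T₂⟧⟦T₁⟧ → O⟦T₁⟧` at `T₂ = u`

Door 5's `ev₂ hu` (`u ∈ 𝔪_O`) satisfies the two hypotheses used below (`ev₂_fibreSection`,
`ker_ev₂`); they are kept abstract so that this file does not depend on the Cruxes module. -/

section Eval

variable {O : Type*} [CommRing O] {u : O} (π : PowerSeries (PowerSeries O) →+* PowerSeries O)
  (hsec : ∀ b, π (fibreSection O b) = b)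
  (hker : ∀ F, π F = 0 → F ∈ Ideal.span {verticalPrimeO O u})

include hsec hker in
/-- If `π F ∈ I` then `F ∈ I·(section) + ker π`: `F = section(π F) + (F - section(π F))`. [folklore] -/
theorem mem_map_sup_of_eval_mem {I : Ideal (PowerSeries O)} {F : PowerSeries (PowerSeries O)}
    (h : π F ∈ I) : F ∈ I.map (fibreSection O) ⊔ Ideal.span {verticalPrimeO O u} := by
  have hF : F = fibreSection O (π F) + (F - fibreSection O (π F)) := by ring
  rw [hF]
  refine Ideal.add_mem _ (Ideal.mem_sup_left (Ideal.mem_map_of_mem _ h))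
    (Ideal.mem_sup_right (hker _ ?_))
  rw [map_sub, hsec, sub_self]

include hsec in
/-- Converse: if `π` kills `T₂ - u` then `F ∈ I·(section) + (T₂ - u)` gives `π F ∈ I`. [folklore] -/
theorem eval_mem_of_mem_map_sup (hvan : π (verticalPrimeO O u) = 0) {I : Ideal (PowerSeries O)}
    {F : PowerSeries (PowerSeries O)} (h : F ∈ I.map (fibreSection O) ⊔ Ideal.span {verticalPrimeO O u}) :
    π F ∈ I := by
  obtain ⟨a, ha, b, hb, rfl⟩ := Submodule.mem_sup.mp h
  obtain ⟨c, rfl⟩ := Ideal.mem_span_singleton'.mp hb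
  rw [map_add, map_mul, hvan, mul_zero, add_zero]
  have hle : (I.map (fibreSection O)).map π ≤ I := by
    rw [Ideal.map_map, show π.comp (fibreSection O) = RingHom.id _ from RingHom.ext hsec, Ideal.map_id]
  exact hle (Ideal.mem_map_of_mem _ ha)

include hsec in
theorem eval_parasiteO (u₁ : O) : π (parasiteO O u₁) = PowerSeries.X - PowerSeries.C (R := O) u₁ :=
  hsec _

include hsec hker in
/-- **Slot producer**: a bound `p^t (T₁ - u₁)^m · π G ∈ ch_{O⟦T₁⟧}(Y/(T₂-u)Y)` in the fibre ring
gives `FibreBoundAtPar`. [folklore] -/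
theorem fibreBoundAtPar_of_eval_mem (p : ℕ) (Y : Type*) [AddCommGroup Y]
    [Module (PowerSeries (PowerSeries O)) Y] (G : PowerSeries (PowerSeries O)) (u₁ : O) (t m : ℕ)
    (h : (p : PowerSeries O) ^ t * (PowerSeries.X - PowerSeries.C (R := O) u₁) ^ m * π G ∈
      fibreCharIdeal O u Y) :
    FibreBoundAtPar O p Y G u u₁ t m := by
  refine mem_map_sup_of_eval_mem π hsec hker ?_
  rwa [map_mul, map_mul, map_pow, map_pow, map_natCast, eval_parasiteO π hsec]

include hsec in
/-- … and conversely (for `π` killing `T₂ - u`), so the slot is EXACTLY the fibre-ring statement.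
[folklore] -/
theorem eval_mem_of_fibreBoundAtPar (hvan : π (verticalPrimeO O u) = 0) (p : ℕ) (Y : Type*)
    [AddCommGroup Y] [Module (PowerSeries (PowerSeries O)) Y] (G : PowerSeries (PowerSeries O))
    (u₁ : O) (t m : ℕ) (h : FibreBoundAtPar O p Y G u u₁ t m) :
    (p : PowerSeries O) ^ t * (PowerSeries.X - PowerSeries.C (R := O) u₁) ^ m * π G ∈
      fibreCharIdeal O u Y := by
  have := eval_mem_of_mem_map_sup π hsec hvan h
  rwa [map_mul, map_mul, map_pow, map_pow, map_natCast, eval_parasiteO π hsec] at this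

end Eval

/-! ## §3 The line endgame over an abstract Noetherian factorial domain `R` -/

section Line

variable {R : Type*} [CommRing R]

/-- `R/(x)` is torsion for `x ≠ 0` in a domain. [folklore] -/
theorem isTorsion_quotient_span_singleton [IsDomain R] {x : R} (hx : x ≠ 0) :
    Module.IsTorsion R (R ⧸ Ideal.span {x}) := by
  intro q
  refine ⟨⟨x, mem_nonZeroDivisors_of_ne_zero hx⟩, ?_⟩
  obtain ⟨r, rfl⟩ := Submodule.Quotient.mk_surjective _ q
  rw [Submonoid.mk_smul, ← Submodule.Quotient.mk_smul, Submodule.Quotient.mk_eq_zero, smul_eq_mul]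
  exact Ideal.mul_mem_right r _ (Ideal.mem_span_singleton_self x)

variable {H : Type*} [AddCommGroup H] [Module R H]

/-- **Torsion of `H/R·h₀` from an injective functional.** If `Log : H → R` is injective and
`Log h₀ = x ≠ 0`, then `x` kills `H/R·h₀`: `x·h = (Log h)·h₀` since both have the same `Log`.
(On the line: `H¹_•(K_v,T_ℓ)/Λ_ℓ·loc_v BF^•_ℓ` is torsion.) [folklore] -/
theorem isTorsion_quotient_of_functional [IsDomain R] (Log : H →ₗ[R] R)
    (hLog : Function.Injective Log) (h₀ : H) {x : R} (hx : Log h₀ = x) (hx0 : x ≠ 0) :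
    Module.IsTorsion R (H ⧸ (R ∙ h₀)) := by
  intro q
  refine ⟨⟨x, mem_nonZeroDivisors_of_ne_zero hx0⟩, ?_⟩
  obtain ⟨h, rfl⟩ := Submodule.Quotient.mk_surjective _ q
  rw [Submonoid.mk_smul, ← Submodule.Quotient.mk_smul, Submodule.Quotient.mk_eq_zero,
    Submodule.mem_span_singleton]
  refine ⟨Log h, hLog ?_⟩
  rw [map_smul, map_smul, hx, smul_eq_mul, smul_eq_mul, mul_comm]

/-- **`x ∈ char(H/R·h₀)` from an injective functional with `Log h₀ = x`** (Noetherian factorial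
domain, `H` finitely generated): `Log` induces `H/R·h₀ ↪ R/(x)`, so `(x) = char(R/(x)) =
char(H/R·h₀) · char(coker) ⊆ char(H/R·h₀)`. NO hypothesis on `coker Log` is used. (On the line:
`L̃og_ℓ(loc_v BF^•_ℓ) ∈ char(H¹_•(K_v,T_ℓ)/Λ_ℓ·loc_v BF^•_ℓ)`.) [cite: Washington1997, §13.2] -/
theorem mem_charIdeal_quotient_of_functional [IsNoetherianRing R] [IsDomain R]
    [UniqueFactorizationMonoid R] [Module.Finite R H] (Log : H →ₗ[R] R)
    (hLog : Function.Injective Log) (h₀ : H) {x : R} (hx : Log h₀ = x) :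
    x ∈ Module.charIdeal R (H ⧸ (R ∙ h₀)) := by
  by_cases hx0 : x = 0
  · rw [hx0]; exact Ideal.zero_mem _
  have hle : (R ∙ h₀) ≤ LinearMap.ker ((Ideal.span {x}).mkQ ∘ₗ Log) := by
    rw [Submodule.span_le, Set.singleton_subset_iff, SetLike.mem_coe, LinearMap.mem_ker,
      LinearMap.comp_apply, Submodule.mkQ_apply, hx, Submodule.Quotient.mk_eq_zero]
    exact Ideal.mem_span_singleton_self x
  set φ : (H ⧸ (R ∙ h₀)) →ₗ[R] R ⧸ Ideal.span {x} := (R ∙ h₀).liftQ ((Ideal.span {x}).mkQ ∘ₗ Log) hle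
    with hφdef
  have hφ : Function.Injective φ := by
    rw [← LinearMap.ker_eq_bot, LinearMap.ker_eq_bot']
    intro q hq
    obtain ⟨h, rfl⟩ := Submodule.Quotient.mk_surjective _ q
    rw [hφdef, Submodule.liftQ_apply, LinearMap.comp_apply, Submodule.mkQ_apply,
      Submodule.Quotient.mk_eq_zero, Ideal.mem_span_singleton'] at hq
    obtain ⟨a, ha⟩ := hq
    rw [Submodule.Quotient.mk_eq_zero, Submodule.mem_span_singleton]
    exact ⟨a, hLog (by rw [map_smul, hx, smul_eq_mul, ha])⟩
  have hmul := Module.charIdeal_eq_mul_of_exact (isTorsion_quotient_span_singleton hx0) φ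
    (LinearMap.range φ).mkQ hφ (Submodule.mkQ_surjective _) (LinearMap.exact_map_mkQ_range φ)
  have hle' : Module.charIdeal R (R ⧸ Ideal.span {x}) ≤ Module.charIdeal R (H ⧸ (R ∙ h₀)) :=
    hmul ▸ Ideal.mul_le_right
  exact hle' (by rw [Module.charIdeal_quotient_span_singleton hx0]; exact Ideal.mem_span_singleton_self x)

variable {Hrel Hloc Xrs Xss : Type*} [AddCommGroup Hrel] [Module R Hrel] [AddCommGroup Hloc]
  [Module R Hloc] [AddCommGroup Xrs] [Module R Xrs] [AddCommGroup Xss] [Module R Xss]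

/-- **The four-term chase of (eq:PT1).** Along `0 → Hrel →res Hloc →δ Xrs →πs Xss → 0` (`res`
injective), dividing the first two terms by the line spanned by `z` / `res z` keeps exactness; if
`Hloc/R·res z` and `Xss` are f.g. torsion, `char Xrs = char(im δ̄)·char Xss` and `char(Hloc/R·res z) =
char(Hrel/R·z)·char(im δ̄)`, so the Kolyvagin-system bound `char(Hrel/R·z) ≤ char Xss` gives
`char(Hloc/R·res z) ≤ char Xrs`. [cite: NeukirchSchmidtWingberg2008, Ch. V §3, Remark 2 after (5.3.9)] -/
theorem charIdeal_quotient_le_of_fourTerm [IsNoetherianRing R] [IsDomain R]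
    [Module.Finite R Hloc] [Module.Finite R Xss]
    (res : Hrel →ₗ[R] Hloc) (δ : Hloc →ₗ[R] Xrs) (πs : Xrs →ₗ[R] Xss)
    (hres : Function.Injective res) (h₁ : Function.Exact res δ) (h₂ : Function.Exact δ πs)
    (hπs : Function.Surjective πs) (z : Hrel)
    (hQ : Module.IsTorsion R (Hloc ⧸ (R ∙ res z))) (hXss : Module.IsTorsion R Xss)
    (hKS : Module.charIdeal R (Hrel ⧸ (R ∙ z)) ≤ Module.charIdeal R Xss) :
    Module.charIdeal R (Hloc ⧸ (R ∙ res z)) ≤ Module.charIdeal R Xrs := by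
  have hle₁ : (R ∙ z) ≤ (R ∙ res z).comap res := by
    rw [Submodule.span_le, Set.singleton_subset_iff, SetLike.mem_coe, Submodule.mem_comap]
    exact Submodule.mem_span_singleton_self _
  have hle₂ : (R ∙ res z) ≤ LinearMap.ker δ := by
    rw [Submodule.span_le, Set.singleton_subset_iff, SetLike.mem_coe, LinearMap.mem_ker]
    exact h₁.apply_apply_eq_zero z
  set rb : (Hrel ⧸ (R ∙ z)) →ₗ[R] Hloc ⧸ (R ∙ res z) := Submodule.mapQ _ _ res hle₁ with hrbdef
  set db : (Hloc ⧸ (R ∙ res z)) →ₗ[R] Xrs := (R ∙ res z).liftQ δ hle₂ with hdbdef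
  -- `rb` injective (uses `res` injective)
  have hrb : Function.Injective rb := by
    rw [← LinearMap.ker_eq_bot, LinearMap.ker_eq_bot']
    intro q hq
    obtain ⟨a, rfl⟩ := Submodule.Quotient.mk_surjective _ q
    rw [hrbdef, Submodule.mapQ_apply, Submodule.Quotient.mk_eq_zero, Submodule.mem_span_singleton] at hq
    obtain ⟨r, hr⟩ := hq
    rw [Submodule.Quotient.mk_eq_zero, Submodule.mem_span_singleton]
    exact ⟨r, hres (by rw [map_smul, hr])⟩
  -- exactness at `Hloc/R·res z`
  have hex₁ : Function.Exact rb db := by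
    intro q
    obtain ⟨h, rfl⟩ := Submodule.Quotient.mk_surjective _ q
    rw [hdbdef, Submodule.liftQ_apply]
    constructor
    · intro hh
      obtain ⟨a, ha⟩ := (h₁ h).mp hh
      exact ⟨Submodule.Quotient.mk a, by rw [hrbdef, Submodule.mapQ_apply, ha]⟩
    · rintro ⟨q', hq'⟩
      obtain ⟨a, rfl⟩ := Submodule.Quotient.mk_surjective _ q'
      rw [hrbdef, Submodule.mapQ_apply, Submodule.Quotient.eq, Submodule.mem_span_singleton] at hq'
      obtain ⟨r, hr⟩ := hq'
      have : h = res (a - r • z) := by rw [map_sub, map_smul, hr, sub_sub_cancel]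
      rw [this]
      exact h₁.apply_apply_eq_zero _
  -- exactness at `Xrs`
  have hex₂ : Function.Exact db πs := by
    intro x
    rw [h₂ x]
    constructor
    · rintro ⟨h, rfl⟩
      exact ⟨Submodule.Quotient.mk h, by rw [hdbdef, Submodule.liftQ_apply]⟩
    · rintro ⟨q, rfl⟩
      obtain ⟨h, rfl⟩ := Submodule.Quotient.mk_surjective _ q
      exact ⟨h, by rw [hdbdef, Submodule.liftQ_apply]⟩
  -- the two short exact pieces
  have e₁ := Module.charIdeal_eq_mul_of_exact hQ rb db.rangeRestrict hrb
    (LinearMap.surjective_rangeRestrict db)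
    (by rw [LinearMap.exact_iff, LinearMap.ker_rangeRestrict, hex₁.linearMap_ker_eq])
  have hsub : Function.Exact (LinearMap.range db).subtype πs := by
    rw [LinearMap.exact_iff, hex₂.linearMap_ker_eq, Submodule.range_subtype]
  haveI : Module.Finite R Xrs := Module.Finite.of_exact hsub hπs
  have hXrs : Module.IsTorsion R Xrs := Module.isTorsion_of_exact db πs hex₂ hQ hXss
  have e₂ := Module.charIdeal_eq_mul_of_exact hXrs (LinearMap.range db).subtype πs
    (Submodule.injective_subtype _) hπs hsub
  rw [e₁, e₂]
  exact (mul_comm _ _).le.trans (Ideal.mul_mono_right hKS)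

/-- `Xrs` is torsion under the hypotheses of the chase (needed by consumers that multiply
characteristic ideals further). [folklore] -/
theorem isTorsion_of_fourTerm (δ : Hloc →ₗ[R] Xrs) (πs : Xrs →ₗ[R] Xss)
    (h₂ : Function.Exact δ πs) (z : Hrel) (res : Hrel →ₗ[R] Hloc) (h₁ : Function.Exact res δ)
    (hQ : Module.IsTorsion R (Hloc ⧸ (R ∙ res z))) (hXss : Module.IsTorsion R Xss) :
    Module.IsTorsion R Xrs := by
  have hle₂ : (R ∙ res z) ≤ LinearMap.ker δ := by
    rw [Submodule.span_le, Set.singleton_subset_iff, SetLike.mem_coe, LinearMap.mem_ker]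
    exact h₁.apply_apply_eq_zero z
  refine Module.isTorsion_of_exact ((R ∙ res z).liftQ δ hle₂) πs (fun x => ?_) hQ hXss
  rw [h₂ x]
  constructor
  · rintro ⟨h, rfl⟩
    exact ⟨Submodule.Quotient.mk h, by rw [Submodule.liftQ_apply]⟩
  · rintro ⟨q, rfl⟩
    obtain ⟨h, rfl⟩ := Submodule.Quotient.mk_surjective _ q
    exact ⟨h, by rw [Submodule.liftQ_apply]⟩

/-- **THE LINE ENDGAME** (abstract form). Over a Noetherian factorial domain `R`: Poitou–Tate data
`0 → Hrel → Hloc → Xrs → Xss → 0` with `res` injective, a class `z ∈ Hrel`, an injective functional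
`Log : Hloc → R` with `Log (res z) = x`, and the Kolyvagin-system bound `char(Hrel/R·z) ≤ char Xss`
(`Xss` torsion) give `x ∈ char Xrs`. [cite: MazurRubin2004, Thm. 5.3.10]
[cite: NeukirchSchmidtWingberg2008, Ch. V §3] -/
theorem mem_charIdeal_of_line [IsNoetherianRing R] [IsDomain R] [UniqueFactorizationMonoid R]
    [Module.Finite R Hloc] [Module.Finite R Xss]
    (res : Hrel →ₗ[R] Hloc) (δ : Hloc →ₗ[R] Xrs) (πs : Xrs →ₗ[R] Xss)
    (hres : Function.Injective res) (h₁ : Function.Exact res δ) (h₂ : Function.Exact δ πs)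
    (hπs : Function.Surjective πs) (z : Hrel) (Log : Hloc →ₗ[R] R) (hLog : Function.Injective Log)
    {x : R} (hx : Log (res z) = x) (hXss : Module.IsTorsion R Xss)
    (hKS : Module.charIdeal R (Hrel ⧸ (R ∙ z)) ≤ Module.charIdeal R Xss) :
    x ∈ Module.charIdeal R Xrs := by
  by_cases hx0 : x = 0
  · rw [hx0]; exact Ideal.zero_mem _
  exact charIdeal_quotient_le_of_fourTerm res δ πs hres h₁ h₂ hπs z
    (isTorsion_quotient_of_functional Log hLog (res z) hx hx0) hXss hKS
    (mem_charIdeal_quotient_of_functional Log hLog (res z) hx)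

/-- **… transported through fibre control.** A pseudo-isomorphism `ctrl : Xfib → Xrs` (pseudo-null
kernel and cokernel) has `char Xfib = char Xrs`, so the endgame's element lands in `char Xfib`.
[cite: Washington1997, §13.2] -/
theorem mem_charIdeal_fibre_of_line [IsNoetherianRing R] [IsDomain R] [UniqueFactorizationMonoid R]
    [Module.Finite R Hloc] [Module.Finite R Xss]
    {Xfib : Type*} [AddCommGroup Xfib] [Module R Xfib]
    (res : Hrel →ₗ[R] Hloc) (δ : Hloc →ₗ[R] Xrs) (πs : Xrs →ₗ[R] Xss)
    (hres : Function.Injective res) (h₁ : Function.Exact res δ) (h₂ : Function.Exact δ πs)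
    (hπs : Function.Surjective πs) (z : Hrel) (Log : Hloc →ₗ[R] R) (hLog : Function.Injective Log)
    {x : R} (hx : Log (res z) = x) (hXss : Module.IsTorsion R Xss)
    (hKS : Module.charIdeal R (Hrel ⧸ (R ∙ z)) ≤ Module.charIdeal R Xss)
    (ctrl : Xfib →ₗ[R] Xrs) (hctrl : LinearMap.IsPseudoIsomorphism ctrl) :
    x ∈ Module.charIdeal R Xfib := by
  rw [Module.charIdeal_eq_of_arePseudoIsomorphic ⟨ctrl, hctrl⟩]
  exact mem_charIdeal_of_line res δ πs hres h₁ h₂ hπs z Log hLog hx hXss hKS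

/-- **Harmless factors.** If `e · g ∈ char` and `e ∣ c` then `c · g ∈ char`. (On the line:
`e = unit · ϖ^r · (T₁-u₁)^m` with `ϖ^r ∣ p^t`, `c = p^t (T₁-u₁)^m`.) [folklore] -/
theorem mul_mem_of_dvd_of_mul_mem {I : Ideal R} {e c g : R} (he : e ∣ c) (h : e * g ∈ I) :
    c * g ∈ I := by
  obtain ⟨d, rfl⟩ := he
  rw [mul_comm e d, mul_assoc]
  exact I.mul_mem_left d h

end Line

/-! ## §4 The fibre ring `O⟦T₁⟧` of a line and the door-5 output -/

section FibreRing

/-- `O⟦T⟧` is factorial for a DVR `O` (regular local of dimension `2`; Auslander–Buchsbaum), from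
tree theorems. [cite: Matsumura1987, Thm. 19.5 and Thm. 20.3 (PDF p. 179)] -/
theorem uniqueFactorizationMonoid_powerSeries (O : Type u) [CommRing O] [IsDomain O]
    [IsDiscreteValuationRing O] : UniqueFactorizationMonoid (PowerSeries O) := by
  haveI := Literature.NumberTheory.GaloisRepresentations.NearlyOrdinaryPresentationCA.isRegularLocalRing_mvPowerSeries_dvr
    O 1
  exact Literature.AlgebraicGeometry.Resolution.uniqueFactorizationMonoid_of_isRegularLocalRing _
    (IsRegularLocalRing.of_ringEquiv
      (MvPowerSeries.renameEquiv O finOneEquiv.symm).toRingEquiv.symm)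

variable {O : Type u} [CommRing O] [IsDomain O] [IsDiscreteValuationRing O] {u : O}
  (π : PowerSeries (PowerSeries O) →+* PowerSeries O)
  (hsec : ∀ b, π (fibreSection O b) = b)
  (hker : ∀ F, π F = 0 → F ∈ Ideal.span {verticalPrimeO O u})

variable {Hrel Hloc Xrs Xss : Type*} [AddCommGroup Hrel] [Module (PowerSeries O) Hrel]
  [AddCommGroup Hloc] [Module (PowerSeries O) Hloc] [AddCommGroup Xrs] [Module (PowerSeries O) Xrs]
  [AddCommGroup Xss] [Module (PowerSeries O) Xss]

include hsec hker in
/-- **G4 ⟹ door 5 (with parasite slot).** At a point `u` of the pencil, with fibre ring `O⟦T₁⟧`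
(`O` a DVR) and evaluation `π` at `T₂ = u` (door 5's `ev₂ hu`): the line's Poitou–Tate data (PT_ℓ),
its class `z = BF^•_ℓ`, an injective regulator functional `Log` with the explicit reciprocity law
`Log (res z) = e · π G`, `e ∣ p^t (T₁ - u₁)^m` (ERL_ℓ), the Kolyvagin-system bound (KS_ℓ) and a
control pseudo-isomorphism `Y/(T₂-u)Y → X^{rel,str}_ℓ` for the `fibreSection` structure (CTRL_ℓ)
give `FibreBoundAtPar O p Y G u u₁ t m`. The four hypotheses are the TYPED RESIDUAL G4 of the card;
this theorem is their kernel-checked assembly, not a proof of any of them.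
[cite: MazurRubin2004, Thm. 5.3.10] [cite: Washington1997, §13.2] -/
theorem fibreBoundAtPar_of_line [Module.Finite (PowerSeries O) Hloc] [Module.Finite (PowerSeries O) Xss]
    (p : ℕ) (Y : Type*) [AddCommGroup Y] [Module (PowerSeries (PowerSeries O)) Y]
    (G : PowerSeries (PowerSeries O)) (u₁ : O) (t m : ℕ)
    (res : Hrel →ₗ[PowerSeries O] Hloc) (δ : Hloc →ₗ[PowerSeries O] Xrs)
    (πs : Xrs →ₗ[PowerSeries O] Xss) (hres : Function.Injective res) (h₁ : Function.Exact res δ)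
    (h₂ : Function.Exact δ πs) (hπs : Function.Surjective πs) (z : Hrel)
    (Log : Hloc →ₗ[PowerSeries O] PowerSeries O) (hLog : Function.Injective Log)
    (e : PowerSeries O) (he : e ∣ (p : PowerSeries O) ^ t * (PowerSeries.X - PowerSeries.C (R := O) u₁) ^ m)
    (hERL : Log (res z) = e * π G) (hXss : Module.IsTorsion (PowerSeries O) Xss)
    (hKS : Module.charIdeal (PowerSeries O) (Hrel ⧸ ((PowerSeries O) ∙ z)) ≤
      Module.charIdeal (PowerSeries O) Xss)
    (ctrl : letI : Module (PowerSeries O) (QuotSMulTop (verticalPrimeO O u) Y) := fibreModule O u Y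
      QuotSMulTop (verticalPrimeO O u) Y →ₗ[PowerSeries O] Xrs)
    (hctrl : letI : Module (PowerSeries O) (QuotSMulTop (verticalPrimeO O u) Y) := fibreModule O u Y
      LinearMap.IsPseudoIsomorphism ctrl) :
    FibreBoundAtPar O p Y G u u₁ t m := by
  letI : Module (PowerSeries O) (QuotSMulTop (verticalPrimeO O u) Y) := fibreModule O u Y
  haveI := uniqueFactorizationMonoid_powerSeries O
  refine fibreBoundAtPar_of_eval_mem π hsec hker p Y G u₁ t m ?_
  exact mul_mem_of_dvd_of_mul_mem he
    (mem_charIdeal_fibre_of_line res δ πs hres h₁ h₂ hπs z Log hLog hERL hXss hKS ctrl hctrl)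

include hsec hker in
/-- `m = 0` (no parasite, e.g. the regulator is integral at the crossing on this line): door 5's
`FibreBoundAt O p Y G u t` verbatim. [cite: MazurRubin2004, Thm. 5.3.10] [cite: Washington1997, §13.2] -/
theorem fibreBoundAt_of_line [Module.Finite (PowerSeries O) Hloc] [Module.Finite (PowerSeries O) Xss]
    (p : ℕ) (Y : Type*) [AddCommGroup Y] [Module (PowerSeries (PowerSeries O)) Y]
    (G : PowerSeries (PowerSeries O)) (t : ℕ)
    (res : Hrel →ₗ[PowerSeries O] Hloc) (δ : Hloc →ₗ[PowerSeries O] Xrs)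
    (πs : Xrs →ₗ[PowerSeries O] Xss) (hres : Function.Injective res) (h₁ : Function.Exact res δ)
    (h₂ : Function.Exact δ πs) (hπs : Function.Surjective πs) (z : Hrel)
    (Log : Hloc →ₗ[PowerSeries O] PowerSeries O) (hLog : Function.Injective Log)
    (e : PowerSeries O) (he : e ∣ (p : PowerSeries O) ^ t)
    (hERL : Log (res z) = e * π G) (hXss : Module.IsTorsion (PowerSeries O) Xss)
    (hKS : Module.charIdeal (PowerSeries O) (Hrel ⧸ ((PowerSeries O) ∙ z)) ≤
      Module.charIdeal (PowerSeries O) Xss)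
    (ctrl : letI : Module (PowerSeries O) (QuotSMulTop (verticalPrimeO O u) Y) := fibreModule O u Y
      QuotSMulTop (verticalPrimeO O u) Y →ₗ[PowerSeries O] Xrs)
    (hctrl : letI : Module (PowerSeries O) (QuotSMulTop (verticalPrimeO O u) Y) := fibreModule O u Y
      LinearMap.IsPseudoIsomorphism ctrl) :
    FibreBoundAt O p Y G u t := by
  rw [← fibreBoundAtPar_zero_iff p Y G u 0 t]
  exact fibreBoundAtPar_of_line π hsec hker p Y G 0 t 0 res δ πs hres h₁ h₂ hπs z Log hLog e
    (by rwa [pow_zero, mul_one]) hERL hXss hKS ctrl hctrl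

end FibreRing

/-! ## §5 (v1.1) The parasite as a GLOBAL factor: door 5 verbatim, no engine slot G1″

Three kernel steps and two algebraic shadows (see the module docstring, «v1.1»):
(5a) uniformity of the clearing exponent `m₀` and injectivity of the cleared regulator;
(5b) the per-line producer for `G' = Q · G` (`Q = ϖ_P^{m₀}` base-changed to `O⟦T₂⟧⟦T₁⟧`) — this is
     `fibreBoundAt_of_line` with the explicit reciprocity law read for the integral map `ϖ_P^{m₀} · L̃og`;
(5c) after ANY engine `FB G' → ∃ a, (p^a · G') ⊆ ch X` (door 5's shape), the factor `ϖ_P^{m₀}` of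
     `G'` is stripped by promotion at a prime of length zero (G5). -/

section Parasite

/-- (5a) **Uniform clearing exponent.** If every value of a linear map on a finitely generated module
becomes «integral» (lands in a fixed submodule `N`) after multiplication by some power of `ϖ`, then ONE
power works for all values. (Applied to `L̃og^•_𝔭 : H¹_•(K_𝔭, 𝐓) → Frac`, `N = Λ₂`, `ϖ = γ_ac − 1`:
CCSS18, arXiv:1804.10993 p. 14 L1–11, «integral up to exceptional primes».) [folklore] -/
theorem exists_uniform_pow_smul_mem {R : Type*} [CommRing R] {H M : Type*} [AddCommGroup H]
    [Module R H] [Module.Finite R H] [AddCommGroup M] [Module R M] (L : H →ₗ[R] M)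
    (N : Submodule R M) (ϖ : R) (h : ∀ x, ∃ m : ℕ, ϖ ^ m • L x ∈ N) :
    ∃ m₀ : ℕ, ∀ x, ϖ ^ m₀ • L x ∈ N := by
  classical
  obtain ⟨s, hs⟩ := Module.Finite.fg_top (R := R) (M := H)
  choose m hm using h
  refine ⟨s.sup m, fun x => ?_⟩
  have hx : x ∈ Submodule.span R (s : Set H) := by rw [hs]; exact Submodule.mem_top
  induction hx using Submodule.span_induction with
  | mem y hy =>
    obtain ⟨k, hk⟩ := Nat.exists_eq_add_of_le (Finset.le_sup (f := m) hy)
    rw [hk, pow_add, mul_comm, mul_smul]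
    exact N.smul_mem _ (hm y)
  | zero => rw [map_zero, smul_zero]; exact N.zero_mem
  | add y z _ _ hy hz => rw [map_add, smul_add]; exact N.add_mem hy hz
  | smul r y _ hy => rw [map_smul, smul_comm]; exact N.smul_mem r hy

/-- (5a′) Multiplying an injective functional by a non-zero scalar of a domain keeps it injective (the
cleared regulator `ϖ_P^{m₀}|_ℓ · L̃og_ℓ` is injective where `L̃og_ℓ` is; `ϖ_P|_ℓ ≠ 0` because no pencil
line lies inside `V(P)`). [folklore] -/
theorem injective_smul_of_injective {R : Type*} [CommRing R] [IsDomain R] {H : Type*} [AddCommGroup H]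
    [Module R H] (Log : H →ₗ[R] R) (hLog : Function.Injective Log) {q : R} (hq : q ≠ 0) :
    Function.Injective (q • Log) := by
  intro x y hxy
  have h : q * Log x = q * Log y := by simpa [LinearMap.smul_apply, smul_eq_mul] using hxy
  exact hLog (mul_left_cancel₀ hq h)

/-- v1.0's point-wise parasite slot IS door 5's slot for the element `parasiteO^m · G` (by `mul_assoc`):
nothing new has to be consumed by the engine. [folklore] -/
theorem fibreBoundAtPar_iff_fibreBoundAt_mul {O : Type*} [CommRing O] {u : O} (p : ℕ) (Y : Type*)
    [AddCommGroup Y] [Module (PowerSeries (PowerSeries O)) Y] (G : PowerSeries (PowerSeries O))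
    (u₁ : O) (t m : ℕ) :
    FibreBoundAtPar O p Y G u u₁ t m ↔ FibreBoundAt O p Y (parasiteO O u₁ ^ m * G) u t := by
  rw [FibreBoundAtPar, fibreBoundAt_iff, mul_assoc]

section PerLine

variable {O : Type u} [CommRing O] [IsDomain O] [IsDiscreteValuationRing O] {u : O}
  (π : PowerSeries (PowerSeries O) →+* PowerSeries O)
  (hsec : ∀ b, π (fibreSection O b) = b)
  (hker : ∀ F, π F = 0 → F ∈ Ideal.span {verticalPrimeO O u})

variable {Hrel Hloc Xrs Xss : Type*} [AddCommGroup Hrel] [Module (PowerSeries O) Hrel]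
  [AddCommGroup Hloc] [Module (PowerSeries O) Hloc] [AddCommGroup Xrs] [Module (PowerSeries O) Xrs]
  [AddCommGroup Xss] [Module (PowerSeries O) Xss]

include hsec hker in
/-- (5b) **G4 ⟹ door 5 for the global element `G' = Q · G`.** The hypotheses of `fibreBoundAt_of_line`
with the explicit reciprocity law read for the CLEARED regulator: `Log (res z) = e · (π Q · π G)`,
`e ∣ p^t` (`Q` = the base change of `ϖ_P^{m₀}`), give door 5's slot `FibreBoundAt O p Y (Q · G) u t`
verbatim — no parasite slot. [cite: MazurRubin2004, Thm. 5.3.10] [cite: Washington1997, §13.2] -/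
theorem fibreBoundAt_parasiteFactor_of_line [Module.Finite (PowerSeries O) Hloc]
    [Module.Finite (PowerSeries O) Xss]
    (p : ℕ) (Y : Type*) [AddCommGroup Y] [Module (PowerSeries (PowerSeries O)) Y]
    (Q G : PowerSeries (PowerSeries O)) (t : ℕ)
    (res : Hrel →ₗ[PowerSeries O] Hloc) (δ : Hloc →ₗ[PowerSeries O] Xrs)
    (πs : Xrs →ₗ[PowerSeries O] Xss) (hres : Function.Injective res) (h₁ : Function.Exact res δ)
    (h₂ : Function.Exact δ πs) (hπs : Function.Surjective πs) (z : Hrel)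
    (Log : Hloc →ₗ[PowerSeries O] PowerSeries O) (hLog : Function.Injective Log)
    (e : PowerSeries O) (he : e ∣ (p : PowerSeries O) ^ t)
    (hERL : Log (res z) = e * (π Q * π G)) (hXss : Module.IsTorsion (PowerSeries O) Xss)
    (hKS : Module.charIdeal (PowerSeries O) (Hrel ⧸ ((PowerSeries O) ∙ z)) ≤
      Module.charIdeal (PowerSeries O) Xss)
    (ctrl : letI : Module (PowerSeries O) (QuotSMulTop (verticalPrimeO O u) Y) := fibreModule O u Y
      QuotSMulTop (verticalPrimeO O u) Y →ₗ[PowerSeries O] Xrs)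
    (hctrl : letI : Module (PowerSeries O) (QuotSMulTop (verticalPrimeO O u) Y) := fibreModule O u Y
      LinearMap.IsPseudoIsomorphism ctrl) :
    FibreBoundAt O p Y (Q * G) u t :=
  fibreBoundAt_of_line π hsec hker p Y (Q * G) t res δ πs hres h₁ h₂ hπs z Log hLog e he
    (by rw [map_mul]; exact hERL) hXss hKS ctrl hctrl

end PerLine

section Strip

variable {Λ : Type*} [CommRing Λ] [IsDomain Λ] [IsNoetherianRing Λ] [UniqueFactorizationMonoid Λ]
  {X : Type*} [AddCommGroup X] [Module Λ X] [Module.Finite Λ X]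

/-- (5c) **Stripping the global parasite factor** (promotion at a prime of length zero, tree
`Module.le_charIdeal_of_span_pow_mul_le`): `(c · ϖ^m · G) ⊆ ch X` and `ℓ_{(ϖ)}(X) = 0` give
`(c · G) ⊆ ch X`. The hypothesis `ℓ_{(ϖ)}(X) = 0` for `ϖ = ϖ_P` is G5 (`SplitsliceG5red.g5_package` (ii)).
[cite: NeukirchSchmidtWingberg2008, Ch. V §3, (5.3.9)–(5.3.10)] [cite: Washington1997, §13.2] -/
theorem strip_parasiteFactor (hX : Module.IsTorsion Λ X) {ϖ : Λ} (hϖ : Prime ϖ)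
    (hℓ : ∀ 𝔭 : PrimeSpectrum Λ, 𝔭.asIdeal = Ideal.span {ϖ} → Module.lengthAt Λ X 𝔭 = 0)
    {c G : Λ} {m : ℕ} (h : Ideal.span {c * (ϖ ^ m * G)} ≤ Module.charIdeal Λ X) :
    Ideal.span {c * G} ≤ Module.charIdeal Λ X := by
  refine Module.le_charIdeal_of_span_pow_mul_le hX hϖ hℓ (m := m) ?_
  rwa [Ideal.span_singleton_mul_span_singleton,
    show ϖ ^ m * (c * G) = c * (ϖ ^ m * G) by ring]

/-- (5c′) **No engine slot G1″.** For ANY engine of door 5's shape — fibre bounds `FB G'` for an element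
`G'` yield `∃ a, (p^a · G') ⊆ ch X` (`QtameDoor5.engine_door5*`, whose only other use of `G'` is the
always-true `PatchingTarget`) — feeding it the GLOBAL element `G' = ϖ^m · G` and stripping with (5c)
returns door 5's own conclusion for `G`. [cite: NeukirchSchmidtWingberg2008, Ch. V §3, (5.3.9)–(5.3.10)]
[cite: Washington1997, §13.2] -/
theorem engine_output_of_parasiteFactor (hX : Module.IsTorsion Λ X) {ϖ : Λ} (hϖ : Prime ϖ)
    (hℓ : ∀ 𝔭 : PrimeSpectrum Λ, 𝔭.asIdeal = Ideal.span {ϖ} → Module.lengthAt Λ X 𝔭 = 0)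
    (p : Λ) (FB : Λ → Prop)
    (engine : ∀ G' : Λ, FB G' → ∃ a : ℕ, Ideal.span {p ^ a * G'} ≤ Module.charIdeal Λ X)
    {G : Λ} {m : ℕ} (hFB : FB (ϖ ^ m * G)) :
    ∃ a : ℕ, Ideal.span {p ^ a * G} ≤ Module.charIdeal Λ X := by
  obtain ⟨a, ha⟩ := engine _ hFB
  exact ⟨a, strip_parasiteFactor hX hϖ hℓ ha⟩

end Strip

end Parasite

end Summit.BirchSwinnertonDyer.BirchSwinnertonDyer.Cruxes.TwoVariableEulerSystemDivisibility.SplitsliceG4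

end
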